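/-
Origin: expansion seat `planner-pub-hodgecm-toy2-g3-0`, handover #2 2026-08-18T06:31:53Z (`HOME/pub-hodgecm-toy2-g3/lean/Toy2g3/TruncAlgMilne.lean`, md5 1c1117ab, 243 lines);
landed by the gen-7 packager in gate run 25 as `HodgeCM/Model/Toy/TruncAlgMilne.lean` (import ^import Toy2g3\.ToyTruncAlg\b→import HodgeCM.Model.Toy.ToyTruncAlg ×1).
-/
/-
Copyright: pub-hodgecm formalisation cell (harness21, 2026). New file (not vendored).
Origin: HOME/pub-hodgecm-toy2-g3/lean/Toy2g3/TruncAlgMilne.lean — session planner-pub-hodgecm-toy2-g3-0 (unit pub-hodgecm-toy2-g3,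
CONSISTENCY seat 2, part (6a)(ii), generation 3).  WIP module `Toy2g3.TruncAlgMilne`; intended final place
`HodgeCM/Model/Toy/TruncAlgMilne.lean` (module `HodgeCM.Model.Toy.TruncAlgMilne`; kind L5 consistency / non-vacuity layer).
WIP import to rewrite on landing: `import Toy2g3.ToyTruncAlg` ↦ `import HodgeCM.Model.Toy.ToyTruncAlg` (this seat, HANDOVER #1 (b)).
-/
import Summits.HodgeConjecture.HodgeCM.Model.Toy.ToyTruncAlg
import Summits.HodgeConjecture.HodgeCM.Model.Toy.ToyGysinDescent

/-!
# Which step of [QW8] Thm 2.5 carries the content: the truncation test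

`Qw8Sufficiency` is assembled (`HodgeCM.Universe.qw8Sufficiency_of_steps'`, StubTree/Qw8.lean) from FIVE obligations:
(i) `Qw8Conj` (a theorem of every universe), (ii) `Qw8ExtProd`, (iii)+(v) `Qw8DualPushPull`, (iv) `Qw8Milne` — the one
PRINT input: Milne, *Lefschetz classes on abelian varieties*, Duke Math. J. 96 (1999), Thm 3.2 / Thm 4.4 / Cor 4.5 /
Cor 4.7, "a weight vector with vanishing Lefschetz character is algebraic" — and the face bridge `Qw8FaceBridge`
(a theorem of `ModelAxioms`).  In the package `Qw8Milne` splits exactly as `Qw8MilnePos ∧ Qw8MilneZero`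
(StubTree/Qw8Milne.lean), and `Qw8MilnePos` is DERIVED from `ModelAxioms`, N1–N4, F4 `Fact_cupAlg`, F5 `Fact_cupAssoc`
(`qw8MilnePos_of_facts`).

This file runs the codimension-two truncation `U.truncAlg` (`HodgeCM.Model.TruncAlg`) over these obligations.  For a
universe `U` with `ModelAxioms` and N1 (N1–N4, F5 and `tr = 0` where indicated):

* `truncAlg_qw8Conj`, `truncAlg_qw8FaceBridge` — steps (i) and the bridge SURVIVE truncation (theorems of every model);
* `truncAlg_qw8MilneZero_iff` — the degree-0 residue is LITERALLY unchanged (degree `0 ≤ 2`);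
* **`not_qw8MilnePos_truncAlg`, `not_qw8Milne_truncAlg` — Milne's step (iv) FAILS in the truncation**: the nonzero
  weight vector of the full weight on `A_{(ℚ(ζ₇),Φ)}` (degree `6`, Lefschetz character `0`) is not in `Alg³ ⊗ ℂ = 0`;
* **`not_fact_cupAlg_truncAlg'` — hence F4 FAILS in the truncation** of any model of `ModelAxioms ∧ N1–N4 ∧ F5` with
  `tr = 0` (sharper than `HodgeCM.Universe.not_fact_cupAlg_truncAlg`, which also assumed F7d, `Fact_dimProd`, `W_RK4`).

Instance `truncModel = toyModel.truncAlg` (§2): `Qw8Milne`, `Qw8MilnePos`, F4 FALSE; `Qw8Conj`, `Qw8FaceBridge`,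
`Qw8MilneZero` TRUE; and in `toyModel` all of them are TRUE (qw8-g4 `toyModel_qw8Milne_of_descent`, toy `fact_cupAlg`).
Headlines: `qw8Milne_independent` — **Milne's theorem, as typed (`Qw8Milne`), is independent of
`ModelAxioms ∧ PohlmannSpan ∧ PohlmannBasis ∧ W_RK4 ∧ Lemma81 ∧ N1–N4 ∧ F5`**, so its citation in the [QW8] route is
load-bearing and the typed statement is not vacuous; `fact_cupAlg_independent` — **F4 is independent of the 28 model
facts together with N1–N4 and F5** (so F4 must stay a separately witnessed input of the generic route: FACTS §1c).

Not decided here: the fate of `Qw8ExtProd` / `Qw8DualPushPull` under truncation (the former should fail for degree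
reasons, the latter should survive vacuously in high degree; neither is needed for the headlines).
-/

noncomputable section

open Module
open Literature.AlgebraicGeometry.Motives (CMType)

namespace HodgeCM

namespace Universe

variable (U : Universe)

/-! ## 1. Generic: the [QW8] obligations under truncation -/

/-- Step (i) survives truncation (it holds in every universe). -/
theorem truncAlg_qw8Conj : U.truncAlg.Qw8Conj := U.truncAlg.qw8Conj_holds

/-- The face bridge survives truncation (it is a theorem of `ModelAxioms`, which survive). -/
theorem truncAlg_qw8FaceBridge (M : U.ModelAxioms) (h0 : ∀ (X : U.Var) (k : ℕ), U.tr X k = 0) :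
    U.truncAlg.Qw8FaceBridge :=
  qw8FaceBridge_holds (M.truncAlg h0)

/- `cmProd F Θ = prodFin n …` is structurally recursive in `n`; with `n` a variable the literal identity
`U.truncAlg.cmProd F Θ = U.cmProd F Θ` is only seen with smart unfolding off (as in `HodgeCM.Model.TruncAlg`). -/
set_option smartUnfolding false in
/-- Weight-vector records of `U` and of `U.truncAlg` are the same data. -/
def WVec.toTruncAlg {U : Universe} {F : CMField} (z : U.WVec F) : U.truncAlg.WVec F :=
  ⟨z.n, z.Θ, z.p, z.S, z.x, z.ne_zero, z.isWeightVector⟩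

set_option smartUnfolding false in
/-- Weight-vector records of `U.truncAlg` and of `U` are the same data. -/
def WVec.ofTruncAlg {U : Universe} {F : CMField} (z : U.truncAlg.WVec F) : U.WVec F :=
  ⟨z.n, z.Θ, z.p, z.S, z.x, z.ne_zero, z.isWeightVector⟩

set_option smartUnfolding false in
/-- (Ported verbatim from the HodgeCMPerL package; no docstring in the source.) -/
theorem WVec.isAlg_toTruncAlg_iff {U : Universe} {F : CMField} (z : U.WVec F) (hp : z.p ≤ 2) :
    z.toTruncAlg.IsAlg ↔ z.IsAlg := by
  change z.x ∈ U.truncAlg.algC (U.cmProd F z.Θ) z.p ↔ z.x ∈ U.algC (U.cmProd F z.Θ) z.p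
  rw [algC, algC, U.truncAlg_alg_of_le hp]
  exact Iff.rfl

set_option smartUnfolding false in
/-- (Ported verbatim from the HodgeCMPerL package; no docstring in the source.) -/
theorem WVec.isAlg_ofTruncAlg_iff {U : Universe} {F : CMField} (z : U.truncAlg.WVec F) (hp : z.p ≤ 2) :
    (WVec.ofTruncAlg z).IsAlg ↔ z.IsAlg := by
  change z.x ∈ U.algC (U.cmProd F z.Θ) z.p ↔ z.x ∈ U.truncAlg.algC (U.cmProd F z.Θ) z.p
  rw [algC, algC, U.truncAlg_alg_of_le hp]
  exact Iff.rfl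

set_option smartUnfolding false in
/-- In codimension `≥ 3` no weight vector of the truncation is algebraic. -/
theorem WVec.not_isAlg_truncAlg {U : Universe} {F : CMField} (z : U.truncAlg.WVec F) (hp : 2 < z.p) : ¬ z.IsAlg := by
  intro h
  have h' : z.x ∈ U.truncAlg.algC (U.truncAlg.cmProd F z.Θ) z.p := h
  rw [U.truncAlg_algC_of_lt hp, Submodule.mem_bot] at h'
  exact z.ne_zero h'

/-- The degree-0 residue of Milne's step is literally unchanged by truncation. -/
theorem truncAlg_qw8MilneZero_iff : U.truncAlg.Qw8MilneZero ↔ U.Qw8MilneZero := by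
  constructor
  · intro h F hG h6 z hp
    exact (WVec.isAlg_toTruncAlg_iff z (by rw [hp]; norm_num)).mp (h F hG h6 z.toTruncAlg hp)
  · intro h F hG h6 z hp
    exact (WVec.isAlg_ofTruncAlg_iff z (by rw [hp]; norm_num)).mp (h F hG h6 (WVec.ofTruncAlg z) hp)

section Separation

variable {U}
variable (M : U.ModelAxioms) (hN1 : U.Fact_cupExterior)
include M hN1

/-- **Milne's step (iv) in positive degree FAILS in the truncation** of a model with N1: the nonzero weight vector of
the full weight on `A_{(ℚ(ζ₇),Φ)}` has degree `[F:ℚ] = 6 > 4` and Lefschetz character `0`, and `Alg³ ⊗ ℂ = 0` there. -/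
theorem not_qw8MilnePos_truncAlg : ¬ U.truncAlg.Qw8MilnePos := by
  intro hMi
  obtain ⟨F, hG, h6, f, -⟩ := HodgeCM.faceHypothesesInhabited
  haveI := hG
  obtain ⟨x, hx, hx0⟩ := exists_weightVector_univ_single M hN1 h6 f.Φ
  have hx' : U.truncAlg.IsWeightVector F (fun _ : Fin (0 + 1) => f.Φ) (fun _ => Finset.univ)
      (2 * (Module.finrank ℚ F / 2)) x := by
    rw [← mem_weightSpace_iff, truncAlg_weightSpace]
    exact hx
  let z : U.truncAlg.WVec F := ⟨0, fun _ => f.Φ, Module.finrank ℚ F / 2, fun _ => Finset.univ, x, hx0, hx'⟩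
  exact WVec.not_isAlg_truncAlg z (by change 2 < Module.finrank ℚ F / 2; omega)
    (hMi F hG h6 z (by change 0 < Module.finrank ℚ F / 2; omega)
      (by change lefChar (fun _ : Fin (0 + 1) => f.Φ) (fun _ => Finset.univ) = 0; exact lefChar_univ_eq_zero _))

/-- **Milne's step (iv) (`Qw8Milne`, all degrees) FAILS in the truncation** of a model with N1. -/
theorem not_qw8Milne_truncAlg : ¬ U.truncAlg.Qw8Milne := fun h =>
  not_qw8MilnePos_truncAlg M hN1 (qw8MilnePos_of_qw8Milne h)

/-- **F4 `Fact_cupAlg` FAILS in the truncation** of any model of `ModelAxioms ∧ N1–N4 ∧ F5` with `tr = 0` — since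
`Qw8MilnePos` is a theorem of `ModelAxioms ∧ N1–N4 ∧ F4 ∧ F5` (`qw8MilnePos_of_facts`) and all of these but F4 survive. -/
theorem not_fact_cupAlg_truncAlg' (hN2 : U.Fact_cup_hodge) (hN3 : U.Fact_pull_H0) (hN4 : U.Fact_hodge_F0)
    (h5 : U.Fact_cupAssoc) (h0 : ∀ (X : U.Var) (k : ℕ), U.tr X k = 0) : ¬ U.truncAlg.Fact_cupAlg := fun h4 =>
  not_qw8MilnePos_truncAlg M hN1
    (qw8MilnePos_of_facts (M.truncAlg h0) ((U.truncAlg_fact_cupExterior_iff).mpr hN1)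
      ((U.truncAlg_fact_cup_hodge_iff).mpr hN2) ((U.truncAlg_fact_pull_H0_iff).mpr hN3)
      ((U.truncAlg_fact_hodge_F0_iff).mpr hN4) h4 ((U.truncAlg_fact_cupAssoc_iff).mpr h5))

end Separation

end Universe

/-! ## 2. The instance `truncModel` and the independence headlines -/

namespace Toy

open Universe

/-- (Ported verbatim from the HodgeCMPerL package; no docstring in the source.) -/
theorem truncModel_qw8Conj : truncModel.Qw8Conj := toyModel.truncAlg_qw8Conj

/-- (Ported verbatim from the HodgeCMPerL package; no docstring in the source.) -/
theorem truncModel_qw8FaceBridge : truncModel.Qw8FaceBridge :=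
  toyModel.truncAlg_qw8FaceBridge toyModel_modelAxioms toyModel_tr_eq_zero

/-- `Qw8MilneZero` holds in `toyModel` (qw8-g4: via F7d) … -/
theorem toyModel_qw8MilneZero : toyModel.Qw8MilneZero :=
  qw8MilneZero_of_qw8Milne toyModel_fact_pull_H0 toyModel_qw8Milne_of_descent

/-- … hence in `truncModel`. -/
theorem truncModel_qw8MilneZero : truncModel.Qw8MilneZero :=
  (toyModel.truncAlg_qw8MilneZero_iff).mpr toyModel_qw8MilneZero

/-- **Milne's step FAILS in `truncModel`** (positive degree). -/
theorem not_truncModel_qw8MilnePos : ¬ truncModel.Qw8MilnePos :=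
  not_qw8MilnePos_truncAlg toyModel_modelAxioms toyModel_fact_cupExterior

/-- **Milne's step FAILS in `truncModel`.** -/
theorem not_truncModel_qw8Milne : ¬ truncModel.Qw8Milne :=
  not_qw8Milne_truncAlg toyModel_modelAxioms toyModel_fact_cupExterior

/-- **F4 FAILS in `truncModel`** (while N1–N4, F5, F7d hold there and F4 holds in `toyModel`). -/
theorem not_truncModel_fact_cupAlg : ¬ truncModel.Fact_cupAlg :=
  not_fact_cupAlg_truncAlg' toyModel_modelAxioms toyModel_fact_cupExterior toyModel_fact_cup_hodge toyModel_fact_pull_H0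
    toyModel_fact_hodge_F0 (fact_cupAssoc exteriorHodgeData) toyModel_tr_eq_zero

/-- F7d `Fact_gysinDescent` HOLDS in `truncModel` (inherited from qw8-g4's `toyModel_fact_gysinDescent`). -/
theorem truncModel_fact_gysinDescent : truncModel.Fact_gysinDescent :=
  Fact_gysinDescent.truncAlg toyModel toyModel_fact_gysinDescent

/-- `Fact_dimProd` HOLDS in `truncModel`. -/
theorem truncModel_fact_dimProd : truncModel.Fact_dimProd :=
  (toyModel.truncAlg_fact_dimProd_iff).mpr toyModel_fact_dimProd

/-- **The [QW8] Thm 2.5 obligations in the two models.**  In `toyModel` all hold; in `truncModel` exactly Milne's step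
(and with it F4 and the conclusion `Qw8Sufficiency`) fails. -/
theorem qw8Steps_profile :
    (toyModel.Qw8Conj ∧ toyModel.Qw8FaceBridge ∧ toyModel.Qw8Milne ∧ toyModel.Qw8MilneZero ∧ toyModel.Fact_cupAlg ∧
        toyModel.Qw8Sufficiency) ∧
      (truncModel.Qw8Conj ∧ truncModel.Qw8FaceBridge ∧ ¬ truncModel.Qw8Milne ∧ truncModel.Qw8MilneZero ∧
        ¬ truncModel.Fact_cupAlg ∧ ¬ truncModel.Qw8Sufficiency) :=
  ⟨⟨toyModel.qw8Conj_holds, qw8FaceBridge_holds toyModel_modelAxioms, toyModel_qw8Milne_of_descent,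
      toyModel_qw8MilneZero, fact_cupAlg, toyModel_qw8Sufficiency⟩,
    ⟨truncModel_qw8Conj, truncModel_qw8FaceBridge, not_truncModel_qw8Milne, truncModel_qw8MilneZero,
      not_truncModel_fact_cupAlg, not_truncModel_qw8Sufficiency⟩⟩

/-- **Milne's theorem as typed (`Qw8Milne`) is independent of `ModelAxioms ∧ PohlmannSpan ∧ PohlmannBasis ∧ W_RK4 ∧
Lemma81 ∧ N1 ∧ N2 ∧ N3 ∧ N4 ∧ F5`.** -/
theorem qw8Milne_independent :
    (∃ U : Universe, U.ModelAxioms ∧ U.PohlmannSpan ∧ U.PohlmannBasis ∧ U.W_RK4 ∧ U.Lemma81 ∧ U.Fact_cupExterior ∧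
        U.Fact_cup_hodge ∧ U.Fact_pull_H0 ∧ U.Fact_hodge_F0 ∧ U.Fact_cupAssoc ∧ U.Qw8Milne) ∧
      ∃ U : Universe, U.ModelAxioms ∧ U.PohlmannSpan ∧ U.PohlmannBasis ∧ U.W_RK4 ∧ U.Lemma81 ∧ U.Fact_cupExterior ∧
        U.Fact_cup_hodge ∧ U.Fact_pull_H0 ∧ U.Fact_hodge_F0 ∧ U.Fact_cupAssoc ∧ ¬ U.Qw8Milne :=
  ⟨⟨toyModel, toyModel_modelAxioms, toyModel_pohlmannSpan', toyModel_pohlmannBasis', toyModel_w_rk4, toyModel_lemma81,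
      toyModel_fact_cupExterior, toyModel_fact_cup_hodge, toyModel_fact_pull_H0, toyModel_fact_hodge_F0,
      fact_cupAssoc exteriorHodgeData, toyModel_qw8Milne_of_descent⟩,
    ⟨truncModel, truncModel_modelAxioms, truncModel_pohlmannSpan, truncModel_pohlmannBasis, truncModel_w_rk4,
      truncModel_lemma81, truncModel_fact_cupExterior, truncModel_fact_cup_hodge, truncModel_fact_pull_H0,
      truncModel_fact_hodge_F0, truncModel_fact_cupAssoc, not_truncModel_qw8Milne⟩⟩

/-- **F4 `Fact_cupAlg` is independent of the 28 model facts together with N1–N4, F5, F7d and `Fact_dimProd`.** -/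
theorem fact_cupAlg_independent :
    (∃ U : Universe, U.ModelAxioms ∧ U.Fact_cupExterior ∧ U.Fact_cup_hodge ∧ U.Fact_pull_H0 ∧ U.Fact_hodge_F0 ∧
        U.Fact_cupAssoc ∧ U.Fact_gysinDescent ∧ U.Fact_dimProd ∧ U.Fact_cupAlg) ∧
      ∃ U : Universe, U.ModelAxioms ∧ U.Fact_cupExterior ∧ U.Fact_cup_hodge ∧ U.Fact_pull_H0 ∧ U.Fact_hodge_F0 ∧
        U.Fact_cupAssoc ∧ U.Fact_gysinDescent ∧ U.Fact_dimProd ∧ ¬ U.Fact_cupAlg :=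
  ⟨⟨toyModel, toyModel_modelAxioms, toyModel_fact_cupExterior, toyModel_fact_cup_hodge, toyModel_fact_pull_H0,
      toyModel_fact_hodge_F0, fact_cupAssoc exteriorHodgeData, toyModel_fact_gysinDescent, toyModel_fact_dimProd,
      fact_cupAlg⟩,
    ⟨truncModel, truncModel_modelAxioms, truncModel_fact_cupExterior, truncModel_fact_cup_hodge, truncModel_fact_pull_H0,
      truncModel_fact_hodge_F0, truncModel_fact_cupAssoc, truncModel_fact_gysinDescent, truncModel_fact_dimProd,
      not_truncModel_fact_cupAlg⟩⟩

/-- The model facts, N1–N4 and F5 do NOT imply F4. -/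
theorem not_fact_cupAlg_of_modelAxiomsN :
    ¬ ∀ U : Universe, U.ModelAxioms → U.Fact_cupExterior → U.Fact_cup_hodge → U.Fact_pull_H0 → U.Fact_hodge_F0 →
      U.Fact_cupAssoc → U.Fact_cupAlg :=
  fun h => not_truncModel_fact_cupAlg (h truncModel truncModel_modelAxioms truncModel_fact_cupExterior
    truncModel_fact_cup_hodge truncModel_fact_pull_H0 truncModel_fact_hodge_F0 truncModel_fact_cupAssoc)

/-- The model facts, Pohlmann's theorem, all rank-four face lines algebraic and N1–N4 do NOT imply Milne's step. -/
theorem not_qw8Milne_of_other_inputs :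
    ¬ ∀ U : Universe, U.ModelAxioms → U.PohlmannSpan → U.PohlmannBasis → U.W_RK4 → U.Fact_cupExterior →
      U.Fact_cup_hodge → U.Fact_pull_H0 → U.Fact_hodge_F0 → U.Qw8Milne :=
  fun h => not_truncModel_qw8Milne (h truncModel truncModel_modelAxioms truncModel_pohlmannSpan truncModel_pohlmannBasis
    truncModel_w_rk4 truncModel_fact_cupExterior truncModel_fact_cup_hodge truncModel_fact_pull_H0
    truncModel_fact_hodge_F0)

end Toy

end HodgeCM

end
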